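import Mathlib

/-!
# stub-ideation k1 (gen 13) sketch — `stub_cmLambdaLower` = RSL_g (stmt-BirchSwinnertonDyer-22608)

TECHNIQUE: weaken / strengthen.  Theme: the LEVEL PLACES `w ∣ M` on the road of record
(`Lines/onepair.lean` v2c, S57 split) and the finiteness clause (8) of the supply datum.

Nothing here proves BSD, RSL_g or `ResidualThetaCountLowerPureAtTwo`; these are pure-algebra
helper lemmas (all PROVED, no `sorry`) that the LEAD may cite:

* `finite_baseChange_of_submodule`      (H-b) `K ⊗ A`, `K ⊗ (B ⧸ A)` finite ⇒ `K ⊗ B` finite;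
* `subsingleton_baseChange_of_torsion`  (H-c) elementwise `R`-torsion ⇒ `K ⊗ M = 0`;
* `finite_baseChange_quotient_of_dualityData` (L1) clause (8) `Module.Finite K (K ⊗ (P ⧸ locd Z))`
  from (DH) + (7) + «`Sg⋆` has finite rank» (= the supply's own hypothesis `hfin` via p665052) —
  no local finiteness at any place, (ORTH) unused;
* `finrank_baseChange_quotient_map_le`   (L2) dropping blocks of `P` can only lower the counted
  `finrank`, once (L1) has made the full quotient `Module.Finite`;
* the `ℤ_[p] / ℚ_[p]` specialisations in the datum's literal currency.
-/

namespace Summit.BirchSwinnertonDyer.BirchSwinnertonDyer.Cruxes.ResidualThetaCountLowerPureAtTwo.SideaK1G13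

open TensorProduct

universe u v w

variable (R : Type u) (K : Type v) [CommRing R] [Field K] [Algebra R K]

/-- (H-b) Extension-closure of «finite rank after base change»: tensoring is right exact, so
`K ⊗ B` is an extension of `K ⊗ (B ⧸ A)` by a quotient of `K ⊗ A`. No flatness needed. -/
theorem finite_baseChange_of_submodule {B : Type w} [AddCommGroup B] [Module R B]
    (A : Submodule R B) [Module.Finite K (K ⊗[R] A)] [Module.Finite K (K ⊗[R] (B ⧸ A))] :
    Module.Finite K (K ⊗[R] B) := by
  let f : K ⊗[R] A →ₗ[K] K ⊗[R] B := A.subtype.baseChange K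
  let g : K ⊗[R] B →ₗ[K] K ⊗[R] (B ⧸ A) := A.mkQ.baseChange K
  have hfg : Function.Exact f g := by
    have h := lTensor_exact K (LinearMap.exact_subtype_mkQ A) (Submodule.mkQ_surjective A)
    intro y
    simpa [f, g, LinearMap.baseChange_eq_ltensor] using h y
  have hg : Function.Surjective g := by
    simpa [g, LinearMap.baseChange_eq_ltensor] using
      LinearMap.lTensor_surjective K (Submodule.mkQ_surjective A)
  haveI : Module.Finite K (LinearMap.range f) := Module.Finite.range f
  haveI : Module.Finite K ((K ⊗[R] B) ⧸ LinearMap.range f) :=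
    Module.Finite.equiv (hfg.linearEquivOfSurjective hg).symm
  exact Module.Finite.of_submodule_quotient (LinearMap.range f)

/-- (H-c) An elementwise `R`-torsion module (each element killed by some `a` that becomes a unit
in `K`) dies after base change to `K`. -/
theorem subsingleton_baseChange_of_torsion {M : Type w} [AddCommGroup M] [Module R M]
    (htor : ∀ m : M, ∃ a : R, IsUnit (algebraMap R K a) ∧ a • m = 0) :
    Subsingleton (K ⊗[R] M) := by
  refine ⟨fun x y ↦ ?_⟩
  suffices h : ∀ z : K ⊗[R] M, z = 0 by rw [h x, h y]
  intro z
  induction z using TensorProduct.induction_on with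
  | zero => rfl
  | tmul k m =>
      obtain ⟨a, ha, ham⟩ := htor m
      obtain ⟨u, hu⟩ := ha
      have : k ⊗ₜ[R] m = (u⁻¹ : Kˣ).1 • ((algebraMap R K a) • (k ⊗ₜ[R] m)) := by
        rw [← mul_smul, ← hu, Units.inv_mul, one_smul]
      rw [this, algebraMap_smul, TensorProduct.smul_tmul', TensorProduct.smul_tmul, ham,
        TensorProduct.tmul_zero, smul_zero]
  | add x y hx hy => rw [hx, hy, add_zero]

theorem finite_baseChange_of_torsion {M : Type w} [AddCommGroup M] [Module R M]
    (htor : ∀ m : M, ∃ a : R, IsUnit (algebraMap R K a) ∧ a • m = 0) :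
    Module.Finite K (K ⊗[R] M) := by
  haveI := subsingleton_baseChange_of_torsion R K htor
  infer_instance

/-- (L1) **Clause (8) of the supply datum is derivable.**  Setting of `IntDualityData` in one
currency: `pair : P → D` (`D = Sg⋆ = CharacterModule Sg`), `locd : H → P`, `Z ≤ H`.  Hypotheses:
`K ⊗ D` finite (⟸ the supply's `hfin` via p665052 `module_finite_characterModule_of_finite_scalarH1_torsion`),
`K ⊗ (H ⧸ Z)` finite (= clause (7)), flatness of `K` over `R` (`ℚ₂ / ℤ₂`: a localisation), and
(DH) with slack `a` a unit in `K`.  Conclusion: `K ⊗ (P ⧸ locd Z)` finite = clause (8).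
(ORTH) is not used; no finiteness of any local block of `P` is used. -/
theorem finite_baseChange_quotient_of_dualityData [Module.Flat R K]
    {P H D : Type w} [AddCommGroup P] [Module R P] [AddCommGroup H] [Module R H]
    [AddCommGroup D] [Module R D]
    (pair : P →ₗ[R] D) (locd : H →ₗ[R] P) (Z : Submodule R H)
    [Module.Finite K (K ⊗[R] D)] [Module.Finite K (K ⊗[R] (H ⧸ Z))]
    (hDH : ∀ t : P, pair t = 0 → ∃ a : R, IsUnit (algebraMap R K a) ∧ ∃ x : H, a • t = locd x) :
    Module.Finite K (K ⊗[R] (P ⧸ Z.map locd)) := by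
  classical
  set LZ : Submodule R P := Z.map locd with hLZ
  set LH : Submodule R P := LinearMap.range locd with hLH
  set Kp : Submodule R P := LinearMap.ker pair with hKp
  have hZH : LZ ≤ LH := by
    rintro _ ⟨x, -, rfl⟩; exact ⟨x, rfl⟩
  -- the two intermediate submodules of `Q := P ⧸ LZ`
  set S₁ : Submodule R (P ⧸ LZ) := LH.map LZ.mkQ with hS₁
  set S₂ : Submodule R (P ⧸ LZ) := (LH ⊔ Kp).map LZ.mkQ with hS₂
  have h12 : S₁ ≤ S₂ := Submodule.map_mono le_sup_left
  -- (a) `K ⊗ S₁` finite: `S₁` is a quotient of `H ⧸ Z`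
  have hZle : Z ≤ LinearMap.ker (LZ.mkQ ∘ₗ locd) := by
    intro x hx
    simp only [LinearMap.mem_ker, LinearMap.coe_comp, Function.comp_apply, Submodule.mkQ_apply,
      Submodule.Quotient.mk_eq_zero]
    exact ⟨x, hx, rfl⟩
  let φ : (H ⧸ Z) →ₗ[R] (P ⧸ LZ) := Z.liftQ (LZ.mkQ ∘ₗ locd) hZle
  have hφ : LinearMap.range φ = S₁ := by
    rw [Submodule.range_liftQ, LinearMap.range_comp, hS₁, hLH]
  haveI hS₁fin : Module.Finite K (K ⊗[R] S₁) := by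
    have hsurj : Function.Surjective (φ.rangeRestrict) := LinearMap.surjective_rangeRestrict φ
    have : Module.Finite K (K ⊗[R] (LinearMap.range φ)) := by
      refine Module.Finite.of_surjective ((φ.rangeRestrict).baseChange K) ?_
      simpa [LinearMap.baseChange_eq_ltensor] using LinearMap.lTensor_surjective K hsurj
    rw [hφ] at this
    exact this
  -- (b) `S₂ ⧸ S₁` is torsion (this is (DH)), hence dies after base change
  let S₁₂ : Submodule R S₂ := S₁.comap S₂.subtype
  haveI : Module.Finite K (K ⊗[R] S₁₂) := by
    let e : S₁ ≃ₗ[R] S₁₂ :=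
      (Submodule.comapSubtypeEquivOfLe h12).symm
    exact Module.Finite.equiv (LinearEquiv.baseChange R K _ _ e)
  haveI : Module.Finite K (K ⊗[R] (S₂ ⧸ S₁₂)) := by
    refine finite_baseChange_of_torsion R K fun m ↦ ?_
    induction m using Submodule.Quotient.induction_on with
    | H s =>
      obtain ⟨s, hs⟩ := s
      rw [hS₂, Submodule.mem_map] at hs
      obtain ⟨p, hp, rfl⟩ := hs
      obtain ⟨l, hl, t, ht, rfl⟩ := Submodule.mem_sup.1 hp
      rw [hKp, LinearMap.mem_ker] at ht
      obtain ⟨a, ha, x, hx⟩ := hDH t ht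
      refine ⟨a, ha, ?_⟩
      rw [← Submodule.Quotient.mk_smul, Submodule.Quotient.mk_eq_zero, Submodule.mem_comap]
      change a • LZ.mkQ (l + t) ∈ S₁
      rw [← map_smul, smul_add, hx, hS₁]
      exact ⟨a • l + locd x, Submodule.add_mem _ (Submodule.smul_mem _ a hl) ⟨x, rfl⟩, rfl⟩
  haveI hS₂fin : Module.Finite K (K ⊗[R] S₂) := finite_baseChange_of_submodule R K S₁₂
  -- (c) `Q ⧸ S₂ ≃ P ⧸ (LH ⊔ Kp)` is a quotient of `P ⧸ Kp ↪ D`: flatness + finiteness of `K ⊗ D`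
  haveI : Module.Finite K (K ⊗[R] ((P ⧸ LZ) ⧸ S₂)) := by
    have hle : LZ ≤ LH ⊔ Kp := hZH.trans le_sup_left
    let e : ((P ⧸ LZ) ⧸ S₂) ≃ₗ[R] P ⧸ (LH ⊔ Kp) := Submodule.quotientQuotientEquivQuotient LZ (LH ⊔ Kp) hle
    -- `P ⧸ Kp ↪ D`
    let ι : (P ⧸ Kp) →ₗ[R] D := Kp.liftQ pair le_rfl
    have hι : Function.Injective ι := by
      rw [← LinearMap.ker_eq_bot]
      exact Submodule.ker_liftQ_eq_bot _ _ _ (by rw [hKp])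
    haveI : Module.Finite K (K ⊗[R] (P ⧸ Kp)) :=
      Module.Finite.of_injective (ι.baseChange K) (by
        simpa [LinearMap.baseChange_eq_ltensor] using
          Module.Flat.lTensor_preserves_injective_linearMap ι hι)
    -- `P ⧸ Kp ↠ P ⧸ (LH ⊔ Kp)`
    let ψ : (P ⧸ Kp) →ₗ[R] P ⧸ (LH ⊔ Kp) := Submodule.factor (le_sup_right : Kp ≤ LH ⊔ Kp)
    have hψ : Function.Surjective ψ := Submodule.factor_surjective _
    haveI : Module.Finite K (K ⊗[R] (P ⧸ (LH ⊔ Kp))) := by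
      refine Module.Finite.of_surjective (ψ.baseChange K) ?_
      simpa [LinearMap.baseChange_eq_ltensor] using LinearMap.lTensor_surjective K hψ
    exact Module.Finite.equiv (LinearEquiv.baseChange R K _ _ e.symm)
  exact finite_baseChange_of_submodule R K S₂

/-- (L2) **Dropping blocks can only lower the counted rank.**  For a surjection `π : P ↠ P♮`
(projection away from the level blocks) and `L ≤ P`: `finrank K (K ⊗ (P♮ ⧸ π L)) ≤ finrank K (K ⊗ (P ⧸ L))`
as soon as the right-hand side is `Module.Finite` (supplied by (L1)).  So the place-cut count
may be run on `2 ∪ good` only, while the level blocks stay inside `P` for (EH)/(DH). -/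
theorem finrank_baseChange_quotient_map_le {P P' : Type w} [AddCommGroup P] [Module R P]
    [AddCommGroup P'] [Module R P'] (π : P →ₗ[R] P') (hπ : Function.Surjective π)
    (L : Submodule R P) [Module.Finite K (K ⊗[R] (P ⧸ L))] :
    Module.finrank K (K ⊗[R] (P' ⧸ L.map π)) ≤ Module.finrank K (K ⊗[R] (P ⧸ L)) := by
  let g : (P ⧸ L) →ₗ[R] (P' ⧸ L.map π) := L.mapQ (L.map π) π (Submodule.le_comap_map π L)
  have hg : Function.Surjective g := by
    rintro ⟨y⟩
    obtain ⟨x, rfl⟩ := hπ y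
    exact ⟨Submodule.Quotient.mk x, rfl⟩
  have hG : Function.Surjective (g.baseChange K) := by
    simpa [LinearMap.baseChange_eq_ltensor] using LinearMap.lTensor_surjective K hg
  calc Module.finrank K (K ⊗[R] (P' ⧸ L.map π))
      = Module.finrank K (LinearMap.range (g.baseChange K)) := by
          rw [LinearMap.range_eq_top.2 hG, finrank_top]
    _ ≤ Module.finrank K (K ⊗[R] (P ⧸ L)) := LinearMap.finrank_range_le _

/-! ### The datum's literal currency: `R = ℤ_[p]`, `K = ℚ_[p]`, slack `a ≠ 0`. -/

instance flat_padic (p : ℕ) [Fact p.Prime] : Module.Flat ℤ_[p] ℚ_[p] :=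
  IsLocalization.flat ℚ_[p] (nonZeroDivisors ℤ_[p])

theorem isUnit_algebraMap_padic {p : ℕ} [Fact p.Prime] {a : ℤ_[p]} (ha : a ≠ 0) :
    IsUnit (algebraMap ℤ_[p] ℚ_[p] a) :=
  (IsFractionRing.to_map_ne_zero_of_mem_nonZeroDivisors (mem_nonZeroDivisors_of_ne_zero ha)).isUnit

/-- (L1) in the currency of `stub_onePairSupply`'s clause (8): with `hDH` exactly as clause (DH)
`∀ t, pair t = 0 → ∃ a : ℤ_[2], a ≠ 0 ∧ ∃ x, a • t = locd x`. -/
theorem finite_padic_baseChange_quotient_of_dualityData (p : ℕ) [Fact p.Prime]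
    {P H D : Type w} [AddCommGroup P] [Module ℤ_[p] P] [AddCommGroup H] [Module ℤ_[p] H]
    [AddCommGroup D] [Module ℤ_[p] D]
    (pair : P →ₗ[ℤ_[p]] D) (locd : H →ₗ[ℤ_[p]] P) (Z : Submodule ℤ_[p] H)
    [Module.Finite ℚ_[p] (ℚ_[p] ⊗[ℤ_[p]] D)] [Module.Finite ℚ_[p] (ℚ_[p] ⊗[ℤ_[p]] (H ⧸ Z))]
    (hDH : ∀ t : P, pair t = 0 → ∃ a : ℤ_[p], a ≠ 0 ∧ ∃ x : H, a • t = locd x) :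
    Module.Finite ℚ_[p] (ℚ_[p] ⊗[ℤ_[p]] (P ⧸ Z.map locd)) :=
  finite_baseChange_quotient_of_dualityData ℤ_[p] ℚ_[p] pair locd Z fun t ht ↦ by
    obtain ⟨a, ha, x, hx⟩ := hDH t ht
    exact ⟨a, isUnit_algebraMap_padic ha, x, hx⟩


/-- (H-a) adapter for the `D`-slot of (L1): the supply's `hfin` gives `Module.Finite 𝒪 (CharacterModule ↥Sg)`
(p665052 `module_finite_characterModule_of_finite_scalarH1_torsion`); `𝒪 = padicCoeffIntegers (Set.range ι)` is
module-finite over `ℤ_[2]`, so `ℚ_[2] ⊗[ℤ_[2]] Sg⋆` is finite over `ℚ_[2]`. -/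
theorem finite_padic_baseChange_of_finite_over (p : ℕ) [Fact p.Prime] (O : Type u) [CommRing O]
    [Algebra ℤ_[p] O] [Module.Finite ℤ_[p] O] (D : Type w) [AddCommGroup D] [Module O D]
    [Module ℤ_[p] D] [IsScalarTower ℤ_[p] O D] [Module.Finite O D] :
    Module.Finite ℚ_[p] (ℚ_[p] ⊗[ℤ_[p]] D) := by
  haveI : Module.Finite ℤ_[p] D := Module.Finite.trans O D
  infer_instance

/-- (H-d, signature only) currency descent for clause (7): `Frac(𝒪) ⊗_𝒪 N` finite over `Frac(𝒪)` ⇒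
`ℚ_[p] ⊗_{ℤ_[p]} N` finite over `ℚ_[p]` (both are the localisation `N[1/p]`, `𝒪` a DVR finite over `ℤ_[p]`;
cf. the T31 «one currency» conversions).  Stated as a `Prop`; the LEAD's (ii_D′) proof can emit either currency. -/
def FracToPadicCurrency (p : ℕ) [Fact p.Prime] (O : Type u) [CommRing O] [IsDomain O] [Algebra ℤ_[p] O]
    (N : Type w) [AddCommGroup N] [Module O N] [Module ℤ_[p] N] [IsScalarTower ℤ_[p] O N] : Prop :=
  Module.Finite (FractionRing O) ((FractionRing O) ⊗[O] N) → Module.Finite ℚ_[p] (ℚ_[p] ⊗[ℤ_[p]] N)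

/-- `Submodule.map locd Z` is the datum's `Submodule.span ℤ_[2] (locd '' Z)`. -/
theorem span_image_eq_map {p : ℕ} [Fact p.Prime] {P H : Type w} [AddCommGroup P] [Module ℤ_[p] P]
    [AddCommGroup H] [Module ℤ_[p] H] (locd : H →ₗ[ℤ_[p]] P) (Z : Submodule ℤ_[p] H) :
    Submodule.span ℤ_[p] (locd '' (Z : Set H)) = Z.map locd := by
  rw [← Submodule.map_span, Submodule.span_eq]

end Summit.BirchSwinnertonDyer.BirchSwinnertonDyer.Cruxes.ResidualThetaCountLowerPureAtTwo.SideaK1G13
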